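import Summits.Ventures.WeilGRH.UniformConductorFloorJointCertSoundB
import Summits.Ventures.WeilGRH.UniformConductorFloorCoprimeCells
import HarnessLib

/-!
# GRH arm (rh-explicit, venture WeilGRH): soundness of the joint cell certificate at LEVEL `m` — divisibility floors

Cell `rh-explicit`, WEIL TRACK — GRH ARM (weil-grh-1, gen7 «divisibility floors»).  For a `JointCert c`
(`UniformConductorFloorJointCertDefs.lean`; integer data on the grid `r = (R−1)/R`, checked by `JointCert.check`) the theorem
`JointCert.weilPositivityOnChar_of_parts` needs the weight bounds `Λ(n)/√n ≤ W_n/D` for EVERY `n ≤ N`.  Here the same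
conclusion is drawn for the characters of the moduli DIVISIBLE BY `m` from the weaker bounds
`Λ(n)/√n ≤ W_n/D` for the `n ≤ N` PRIME TO `m` only (the other weights may be `0`):

* ★ `JointCert.weilPositivityOnChar_of_parts_coprime` — `checkFrame`, all cells, the coprime weight bounds, `ψ₀ ≤ ψ(¼ + κ/2)`,
  `log π − ψ₀ − Clow/D + RHO/D ≤ log Q₀`, `m ∣ q`, `Q₀ ≤ q` ⇒ `WeilPositivityOnChar χ t` for every `χ` mod `q` of parity `κ`
  (via `UniformFloor.weilPositivityOnChar_of_joint_cert_coprime`); `…_of_check_coprime`; `…_one_of_parts_coprime` (window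
  `[-1, 1]` under `checkOne`); `…_of_le_of_parts_coprime` (every window `t' ≤ t`).

Everything is PROVED; no definitions; no named facts; no `ζ` input. [folklore]

## References

* A. Weil (1952), (11) and the «lemme» p. 262 [Weil1952FormulesExplicites]. [folklore]
-/

noncomputable section

open Real MeasureTheory Finset Set
open scoped ArithmeticFunction.vonMangoldt

namespace Summit.Ventures.WeilGRH

open Literature.NumberTheory.LFunctions

namespace UniformFloor

namespace JointCert

variable (c : JointCert)

/-- ★ **SOUNDNESS OF THE JOINT CELL CERTIFICATE AT LEVEL `m`.**  If the frame checks pass, every cell satisfies its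
specification, `Λ(n)/√n ≤ W_n/D` for the `n ≤ N` prime to `m`, `ψ₀ ≤ ψ(¼ + κ/2)` and
`log π − ψ₀ − Clow/D + RHO/D ≤ log Q₀`, then `WeilPositivityOnChar χ t` for EVERY Dirichlet character `χ` of parity `κ` and
EVERY modulus `q ≥ Q₀`, `q ≠ 1`, with `m ∣ q` (`t = J log(R/(R−1))`).  No `ζ` input.
[cite: Weil1952FormulesExplicites, (11) and the «lemme» p. 262] -/
theorem weilPositivityOnChar_of_parts_coprime (hf : c.checkFrame = true) (hcells : ∀ j < c.J, c.cellOKB j = true)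
    {m : ℕ} (hw : ∀ n ∈ range (c.N + 1), (if n.Coprime m then (Λ n : ℝ) / Real.sqrt n else 0) ≤ c.wbar n)
    {ψ₀ : ℝ} (hψ : ψ₀ ≤ (Complex.digamma (((1 / 4 + (c.κ : ℝ) / 2 : ℝ)) : ℂ)).re)
    {Q₀ : ℕ} (hQ₀ : 0 < Q₀) (hB : Real.log Real.pi - ψ₀ - (c.Clow : ℝ) / c.D + (c.RHO : ℝ) / c.D ≤ Real.log Q₀)
    {q : ℕ} (hq : q ≠ 1) (hm : m ∣ q) (hQ : Q₀ ≤ q) (χ : DirichletCharacter ℂ q) (hκ : charParity χ = c.κ) :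
    WeilPositivityOnChar χ c.t := by
  unfold checkFrame at hf
  simp only [Bool.and_eq_true] at hf
  obtain ⟨⟨⟨⟨⟨hsh, hphi⟩, hshf⟩, hsl⟩, hco⟩, hwin⟩ := hf
  obtain ⟨hR, hk0J, hJK, _, hD, _, hlen, _, _, _, _, _⟩ := c.shape_of_checkShape hsh
  have hJ : 0 < c.J := by omega
  have hδt := c.two_t_div hJ
  refine weilPositivityOnChar_of_joint_cert_coprime hq χ hκ hm (c.t_pos hR hJ) (c.exp_two_t_le hsh hwin) hψ hJ c.φ
    (Φ₀ := 1) (Φ₁ := (c.PhiMax : ℝ)) one_pos (c.phi_pos hlen hphi) (c.phi_le hlen hphi) (c.phi_out) c.sfun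
    (c.hs_of_checkShifts hsh hshf) c.wbar hw c.M (k0 := c.k0) (K := c.K) (by omega) c.Ibar ?_ (ρ := c.ρ) ?_
    (C := (c.Clow : ℝ) / c.D) ?_ hQ₀ hQ (by unfold ρ; exact hB)
  · -- slab masses
    intro k hk
    obtain ⟨hk0, hkK⟩ := mem_Ico.1 hk
    by_cases hkJ : k < c.J
    · rw [hδt, c.sum_integral_exp_slab hR k]
      unfold Ibar
      rw [if_pos hkJ]
      exact c.sum_slab_le_Ibar hsh hsl hk0 hkJ
    · unfold Ibar
      rw [if_neg hkJ]
  · -- cells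
    intro j hj
    exact c.hcert_of_cellOKB hsh (mem_range.1 hj) (hcells j (mem_range.1 hj))
  · -- constant
    rw [hδt]
    exact c.Clow_le hsh hco

/-- The same from the one-piece check `c.check = true`. [folklore] -/
theorem weilPositivityOnChar_of_check_coprime (hc : c.check = true)
    {m : ℕ} (hw : ∀ n ∈ range (c.N + 1), (if n.Coprime m then (Λ n : ℝ) / Real.sqrt n else 0) ≤ c.wbar n)
    {ψ₀ : ℝ} (hψ : ψ₀ ≤ (Complex.digamma (((1 / 4 + (c.κ : ℝ) / 2 : ℝ)) : ℂ)).re)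
    {Q₀ : ℕ} (hQ₀ : 0 < Q₀) (hB : Real.log Real.pi - ψ₀ - (c.Clow : ℝ) / c.D + (c.RHO : ℝ) / c.D ≤ Real.log Q₀)
    {q : ℕ} (hq : q ≠ 1) (hm : m ∣ q) (hQ : Q₀ ≤ q) (χ : DirichletCharacter ℂ q) (hκ : charParity χ = c.κ) :
    WeilPositivityOnChar χ c.t := by
  unfold check at hc
  rw [Bool.and_eq_true] at hc
  exact c.weilPositivityOnChar_of_parts_coprime hc.1 (fun j hj ↦ c.cellOKB_of_checkCells hc.2 hj) hw hψ hQ₀ hB hq hm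
    hQ χ hκ

/-- **Every smaller window**: under the hypotheses of `weilPositivityOnChar_of_parts_coprime`, `WeilPositivityOnChar χ t'`
for every `t' ≤ t`. [folklore] -/
theorem weilPositivityOnChar_of_le_of_parts_coprime (hf : c.checkFrame = true) (hcells : ∀ j < c.J, c.cellOKB j = true)
    {m : ℕ} (hw : ∀ n ∈ range (c.N + 1), (if n.Coprime m then (Λ n : ℝ) / Real.sqrt n else 0) ≤ c.wbar n)
    {ψ₀ : ℝ} (hψ : ψ₀ ≤ (Complex.digamma (((1 / 4 + (c.κ : ℝ) / 2 : ℝ)) : ℂ)).re)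
    {Q₀ : ℕ} (hQ₀ : 0 < Q₀) (hB : Real.log Real.pi - ψ₀ - (c.Clow : ℝ) / c.D + (c.RHO : ℝ) / c.D ≤ Real.log Q₀)
    {q : ℕ} (hq : q ≠ 1) (hm : m ∣ q) (hQ : Q₀ ≤ q) (χ : DirichletCharacter ℂ q) (hκ : charParity χ = c.κ)
    {t' : ℝ} (ht' : t' ≤ c.t) :
    WeilPositivityOnChar χ t' := by
  intro g hg hsupp
  exact c.weilPositivityOnChar_of_parts_coprime hf hcells hw hψ hQ₀ hB hq hm hQ χ hκ g hg
    (hsupp.trans (Icc_subset_Icc (by linarith) ht'))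

/-- ★ **THE WINDOW `[-1, 1]` AT LEVEL `m`**: with `checkOne` (`t ≥ 1`) the conclusion holds at `t = 1`. [folklore] -/
theorem weilPositivityOnChar_one_of_parts_coprime (hf : c.checkFrame = true) (hone : c.checkOne = true)
    (hcells : ∀ j < c.J, c.cellOKB j = true)
    {m : ℕ} (hw : ∀ n ∈ range (c.N + 1), (if n.Coprime m then (Λ n : ℝ) / Real.sqrt n else 0) ≤ c.wbar n)
    {ψ₀ : ℝ} (hψ : ψ₀ ≤ (Complex.digamma (((1 / 4 + (c.κ : ℝ) / 2 : ℝ)) : ℂ)).re)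
    {Q₀ : ℕ} (hQ₀ : 0 < Q₀) (hB : Real.log Real.pi - ψ₀ - (c.Clow : ℝ) / c.D + (c.RHO : ℝ) / c.D ≤ Real.log Q₀)
    {q : ℕ} (hq : q ≠ 1) (hm : m ∣ q) (hQ : Q₀ ≤ q) (χ : DirichletCharacter ℂ q) (hκ : charParity χ = c.κ) :
    WeilPositivityOnChar χ 1 := by
  have hsh : c.checkShape = true := by
    unfold checkFrame at hf
    simp only [Bool.and_eq_true] at hf
    exact hf.1.1.1.1.1
  exact c.weilPositivityOnChar_of_le_of_parts_coprime hf hcells hw hψ hQ₀ hB hq hm hQ χ hκ (c.one_le_t hsh hone)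

end JointCert

end UniformFloor

end Summit.Ventures.WeilGRH

end
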